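import Summits.BirchSwinnertonDyer.BirchSwinnertonDyer.Theorems.AdditiveKolyvaginRoadRamifiedHabitatSignLawAnyLevelField
import Summits.BirchSwinnertonDyer.BirchSwinnertonDyer.Theorems.AdditiveKolyvaginRoadSemistabilityDefectDictionary
import Summits.BirchSwinnertonDyer.Rank1Residual.Additive.GordIsogenyInvarianceClasses
import Summits.BirchSwinnertonDyer.Rank1Residual.Additive.AdditiveTorsionFiveSeven
import Summits.BirchSwinnertonDyer.Rank1Residual.Additive.DictionaryUniform
import Summits.BirchSwinnertonDyer.Rank1Residual.Additive.GordManinConstantDegree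
import Summits.BirchSwinnertonDyer.BirchSwinnertonDyer.Theorems.Rank1ResidualIntModelReduction
import HarnessLib

/-!
# Route `AdditiveKolyvaginRoad`, crux KS′ `LevelKolyvaginSystemsAdditive` (stmt-BirchSwinnertonDyer-21396), card `ramified-toric-habitat` —
# the card's FIRST LEMMA `SignLawSupercuspidal` for odd `d_{K′}` IN THE SKETCH'S OWN BINDERS: `Addv W p`, `¬ W.semistabilityDefectAt p ∣ p − 1`,
# `OtherBadPrimesSplit` — no cofactor `M`, no `ord_p Δ`, no `c₄` hypothesis

Cell `pub/bsd-wall`, width seat `bsd-wall-akr-p2x-w2` g12; `--supports stmt-BirchSwinnertonDyer-21396` (helper). THEOREMS ONLY; no definition,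
no named fact, no `sorry`. BSD is not proved by any of this; KS′/KPA′ stay OPEN at `p² ∣ N`.

Sequel of `…RamifiedHabitatSignLawAnyLevelField` (§11–§13: field and global-minimal forms of the ramified-habitat sign law for `E` with ARBITRARY
reduction off `p`). Here §14:

* **`rootNumber_mul_rootNumber_twist_discr_eq_one_of_addv_of_not_semistabilityDefectAt_dvd`** — the sketch's
  `RamifiedToricHabitat.SignLawSupercuspidal` (`Cruxes/LevelKolyvaginSystemsAdditive/RamifiedHabitatKuriharaSlotSketch.lean` §1) FOR ODD `d_{K′}`,
  with its binders and NOTHING ELSE about `E`: `W` globally minimal, `p ≥ 5`, `Addv W p`, `¬ W.semistabilityDefectAt p ∣ p − 1`, `K′` imaginary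
  quadratic with `d_{K′}` odd, `p ∣ d_{K′}`, `OtherBadPrimesSplit W p d_{K′}` spelled out (`∀ q prime, q ∣ N_W → q ≠ p → ((q ≠ 2 → (d_{K′}/q) = 1) ∧
  (q = 2 → d_{K′} ≡ 1 (8)))`) ⟹ `w(E)·w(E^{(d_{K′})}) = +1`. Chain: `f_p = 2` at an additive `p ≥ 5` gives `N = M p²` with `p ∤ M`
  (`condExpTwo_of_addv_of_five_le`); `¬ defect ∣ p − 1` excludes the potentially multiplicative rows (defect `2`, w3 g12's
  `semistabilityDefectAt_dvd_sub_one_of_addv_of_subM`) and type `I₀*`, so `ord_p j ≥ 0`, `a := ord_p Δ_min ∈ {2,3,4,8,9,10}` (census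
  `padicValInt_minimalDiscriminantInt_mem_of_addv_of_padicValRat_j_nonneg`) and `defect = 12/gcd(12,a)` (Serre §5.6 = w3 g12's
  `semistabilityDefectAt_eq_semistabilityIndex`); `p ∣ c₄(W_ℤ)` (`padicValRat_c₄_c₆_of_addv`); then §13 of the prequel. The sketch's idle
  binders `1 < defect` (automatic) and `d_{K′} < −4` are not needed.
* `…_eq_neg_one_of_addv_of_semistabilityDefectAt_dvd` — the PS companion on the POTENTIALLY GOOD non-`I₀*` rows (`0 ≤ ord_p j`,
  `ord_p Δ_min ≠ 6`; on the potentially multiplicative rows the sketch's `SignLawPrincipalSeries` is FALSE, evidence #41; type `I₀*` is g11's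
  `signLaw_IZeroStar_of_isGloballyMinimal` for `M` squarefree, not restated here).

CONDITIONAL on the Modularity Theorem (`exists_isNewformOf`) and Kellock–Dokchitser's Rem. 2.2 at `p` for `E`, `E^{(p*)}` (named fact
`atkinLehnerEigenvalueAt_eq_localRootNumberAt`). BSD is not proved by any of this.

References: [cite: Serre1972, §5.6 (p. 312)] [cite: Rohrlich1993Compositio, Prop. 2(iv)] [cite: KellockDokchitser2023, Rem. 2.2]
[cite: SilvermanATAEC1994, IV Table 4.1 and IV.10.4].
-/

set_option autoImplicit false
set_option linter.dupNamespace false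

noncomputable section

open scoped Classical MatrixGroups NumberTheorySymbols

open CongruenceSubgroup IsDedekindDomain IsDedekindDomain.HeightOneSpectrum NumberField Rat.HeightOneSpectrum
  WeierstrassCurve Literature.NumberTheory.EllipticCurves Literature.NumberTheory.EllipticCurves.ModularForms
  IsDiscreteValuationRing

namespace Summit.BirchSwinnertonDyer.BirchSwinnertonDyer.Theorems.AdditiveKoly.RamifiedHabitat

/-! ## §14 The sketch's own binders: `Addv W p`, `¬ W.semistabilityDefectAt p ∣ p − 1`, `OtherBadPrimesSplit` — no `M`, no `a`, no `c₄` -/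

section Sketch

open Literature.NumberTheory.EllipticCurves.Rank1Residual Summit.BirchSwinnertonDyer.Rank1Residual
  Summit.BirchSwinnertonDyer.Rank1Residual.Additive

variable {p : ℕ} [hp : Fact p.Prime]

/-- **At an additive `p ≥ 5` the conductor is `N = M·p²` with `p ∤ M`** (`f_p = 2`, Silverman *ATAEC* IV.10.4; the census theorem
`condExpTwo_of_addv_of_five_le` read through `N = ∏ p^{f_p}`). [cite: SilvermanATAEC1994, IV.10.2(b) and IV.10.4] -/
theorem conductorNorm_eq_div_mul_sq_of_addv (W : WeierstrassCurve ℚ) [W.IsElliptic] (hp5 : 5 ≤ p) (hadd : Addv W p) :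
    W.conductorNorm ℤ = (W.conductorNorm ℤ / p ^ 2) * p ^ 2 ∧ ¬ p ∣ W.conductorNorm ℤ / p ^ 2 := by
  have hpP : p.Prime := hp.out
  have hN0 : W.conductorNorm ℤ ≠ 0 := (W.conductorNorm_pos_holds).ne'
  have hfac : (W.conductorNorm ℤ).factorization p = 2 := by
    rw [factorization_conductorNorm_primesEquiv_symm W ⟨p, hpP⟩]
    exact condExpTwo_of_addv_of_five_le W p hp5 hadd
  have hp2N : p ^ 2 ∣ W.conductorNorm ℤ := (hpP.pow_dvd_iff_le_factorization hN0).mpr (by rw [hfac])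
  have hp3N : ¬ p ^ 3 ∣ W.conductorNorm ℤ := fun h ↦ by
    have := (hpP.pow_dvd_iff_le_factorization hN0).mp h; omega
  refine ⟨(Nat.div_mul_cancel hp2N).symm, fun ⟨c, hc⟩ ↦ hp3N ⟨c, ?_⟩⟩
  calc W.conductorNorm ℤ = (W.conductorNorm ℤ / p ^ 2) * p ^ 2 := (Nat.div_mul_cancel hp2N).symm
    _ = p ^ 3 * c := by rw [hc]; ring

/-- **At an additive prime of a globally minimal model, `p ∣ c₄(W_ℤ)`** (else the reduction would be multiplicative; census
`padicValRat_c₄_c₆_of_addv`). [cite: SilvermanAEC2009, VII.5 Prop. 5.1] -/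
theorem dvd_c₄_integralModelInt_of_addv (W : WeierstrassCurve ℚ) [W.IsElliptic] [W.IsGloballyMinimal] (hadd : Addv W p) :
    (p : ℤ) ∣ W.integralModelInt.c₄ := by
  have hc : W.c₄ = ((integralModelInt W).c₄ : ℚ) := Summit.BirchSwinnertonDyer.BirchSwinnertonDyer.Rank1Residual.IntModel.c₄_eq_cast rfl
  rcases (padicValRat_c₄_c₆_of_addv W p hadd).1 with h0 | h1
  · rw [hc] at h0
    have : (integralModelInt W).c₄ = 0 := by exact_mod_cast h0
    rw [this]; exact dvd_zero _
  · rw [hc, padicValRat.of_int] at h1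
    have h1' : 1 ≤ padicValInt p (integralModelInt W).c₄ := by exact_mod_cast h1
    by_cases h0 : (integralModelInt W).c₄ = 0
    · rw [h0]; exact dvd_zero _
    · simpa using (padicValInt_dvd_iff 1 (integralModelInt W).c₄).mpr (Or.inr h1')

/-- **Potentially good (`0 ≤ ord_p j`) on a global minimal model reads `c₄ = 0 ∨ ord_p Δ_min ≤ 3·ord_p c₄`** (`j = c₄³/Δ`). [folklore] -/
theorem c₄_eq_zero_or_le_of_padicValRat_j_nonneg (W : WeierstrassCurve ℚ) [W.IsElliptic] [W.IsGloballyMinimal]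
    (hj : 0 ≤ padicValRat p W.j) :
    W.integralModelInt.c₄ = 0 ∨ padicValInt p W.minimalDiscriminantInt ≤ 3 * padicValInt p W.integralModelInt.c₄ := by
  by_cases hc0 : (integralModelInt W).c₄ = 0
  · exact Or.inl hc0
  · right
    have hc : W.c₄ = ((integralModelInt W).c₄ : ℚ) := Summit.BirchSwinnertonDyer.BirchSwinnertonDyer.Rank1Residual.IntModel.c₄_eq_cast rfl
    have hΔ : W.Δ = ((integralModelInt W).Δ : ℚ) := Summit.BirchSwinnertonDyer.BirchSwinnertonDyer.Rank1Residual.IntModel.Δ_eq_cast rfl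
    have hΔ0 : (integralModelInt W).Δ ≠ 0 := minimalDiscriminantInt_ne_zero W
    have hjq : W.j = W.c₄ ^ 3 / W.Δ := by
      rw [WeierstrassCurve.j, ← coe_Δ', div_eq_inv_mul, Units.val_inv_eq_inv_val]
    rw [hjq, hc, hΔ, padicValRat.div (pow_ne_zero _ (by exact_mod_cast hc0)) (by exact_mod_cast hΔ0),
      padicValRat.pow, padicValRat.of_int, padicValRat.of_int] at hj
    have h := hj
    change (0 : ℤ) ≤ 3 * (padicValInt p (integralModelInt W).c₄ : ℤ) - (padicValInt p (minimalDiscriminantInt W) : ℤ) at h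
    omega

/-- **THE CARD'S FIRST LEMMA `SignLawSupercuspidal` FOR ODD `d_{K′}` — in the sketch's own binders, NO cofactor hypothesis.** `W/ℚ` a global
minimal model of an elliptic curve, `p ≥ 5` ADDITIVE (`Addv W p`) with `¬ W.semistabilityDefectAt p ∣ p − 1` (non-abelian inertia: supercuspidal
local type; this EXCLUDES the potentially multiplicative rows and type `I₀*`, whose defect is `2`), `K′` an imaginary quadratic field with
`d_{K′}` ODD, `p ∣ d_{K′}`, and every other bad prime of `W` split in `K′` (the sketch's `OtherBadPrimesSplit W p d_{K′}`, spelled out). Then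
`w(E)·w(E^{(d_{K′})}) = +1` WHATEVER `w(E)` is — for `E` with ARBITRARY reduction at the primes `q ≠ p`. Chain: `f_p = 2` ⟹ `N = M p²`, `p ∤ M`
(`conductorNorm_eq_div_mul_sq_of_addv`); `¬ defect ∣ p − 1` ⟹ `0 ≤ ord_p j` (w3 g12: `semistabilityDefectAt_dvd_sub_one_of_addv_of_subM`) ⟹
`defect = 12/gcd(12, ord_p Δ_min)` (Serre §5.6, `semistabilityDefectAt_eq_semistabilityIndex`) and `ord_p Δ_min ∈ {2,3,4,6,8,9,10}` (census), `≠ 6`;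
`p ∣ c₄(W_ℤ)` (`dvd_c₄_integralModelInt_of_addv`); then §13. CONDITIONAL on the Modularity Theorem (`hmod`) and Kellock–Dokchitser's Rem. 2.2
at `p` for `W`, `W^{(p*)}` (`hF1`, `hF1'`). The sketch's idle binders `1 < defect` and `d_{K′} < −4` are not needed; even `d_{K′}` is not treated.
BSD is not proved by this; KS′/KPA′ stay OPEN. [cite: Serre1972, §5.6 (p. 312)] [cite: Rohrlich1993Compositio, Prop. 2(iv)]
[cite: KellockDokchitser2023, Rem. 2.2] [cite: SilvermanATAEC1994, IV Table 4.1] -/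
theorem rootNumber_mul_rootNumber_twist_discr_eq_one_of_addv_of_not_semistabilityDefectAt_dvd
    (W : WeierstrassCurve ℚ) [W.IsElliptic] [W.IsGloballyMinimal]
    (hmod : exists_isNewformOf) (hF1 : W.atkinLehnerEigenvalueAt_eq_localRootNumberAt)
    (hF1' : (W.quadraticTwist (((-1 : ℤ) ^ (p / 2) * p : ℤ) : ℚ)).atkinLehnerEigenvalueAt_eq_localRootNumberAt)
    (hp5 : 5 ≤ p) (hadd : Addv W p) (hsc : ¬ W.semistabilityDefectAt p ∣ p - 1)
    (K : Type) [Field K] [NumberField K] (hK : IsImaginaryQuadratic K) (hKodd : Odd (NumberField.discr K))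
    (hpd : (p : ℤ) ∣ NumberField.discr K)
    (hsplit : ∀ q : ℕ, q.Prime → (q : ℤ) ∣ (W.conductorNorm ℤ : ℤ) → q ≠ p →
      (q ≠ 2 → jacobiSym (NumberField.discr K) q = 1) ∧ (q = 2 → NumberField.discr K % 8 = 1)) :
    W.rootNumber * (W.quadraticTwist (NumberField.discr K : ℚ)).rootNumber = 1 := by
  have hpP : p.Prime := hp.out
  have hp2 : p ≠ 2 := by omega
  -- `N = M p²`, `p ∤ M`
  obtain ⟨hN, hpM⟩ := conductorNorm_eq_div_mul_sq_of_addv W hp5 hadd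
  set M : ℕ := W.conductorNorm ℤ / p ^ 2 with hM
  -- the other bad primes split
  have hqN : ∀ q ∈ M.primeFactors, (q : ℤ) ∣ (W.conductorNorm ℤ : ℤ) ∧ q ≠ p := fun q hq ↦ by
    refine ⟨?_, ?_⟩
    · rw [hN]; push_cast
      exact Dvd.dvd.mul_right (by exact_mod_cast Nat.dvd_of_mem_primeFactors hq) _
    · rintro rfl; exact hpM (Nat.dvd_of_mem_primeFactors hq)
  have hodd : ∀ q ∈ M.primeFactors, q ≠ 2 → J(NumberField.discr K | q) = 1 := fun q hq hq2 ↦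
    (hsplit q (Nat.prime_of_mem_primeFactors hq) (hqN q hq).1 (hqN q hq).2).1 hq2
  have htwo : 2 ∣ M → NumberField.discr K % 8 = 1 := fun h2 ↦ by
    have h2M : 2 ∈ M.primeFactors := Nat.mem_primeFactors.mpr ⟨Nat.prime_two, h2, fun h ↦ by
      rw [h, zero_mul] at hN; exact (W.conductorNorm_pos_holds).ne' hN⟩
    exact (hsplit 2 Nat.prime_two (hqN 2 h2M).1 (hqN 2 h2M).2).2 rfl
  -- potentially good: the potentially multiplicative rows have defect `2 ∣ p − 1`
  have hj0 : 0 ≤ padicValRat p W.j := by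
    by_contra h
    exact hsc (SemistabilityDefect.semistabilityDefectAt_dvd_sub_one_of_addv_of_subM W p hp5 hadd (not_le.mp h))
  -- Serre's formula and the census list of `ord_p Δ_min`
  have hdef := SemistabilityDefect.semistabilityDefectAt_eq_semistabilityIndex W p hp5 hj0
  rw [hdef] at hsc
  change ¬ 12 / Nat.gcd 12 (padicValInt p W.minimalDiscriminantInt) ∣ p - 1 at hsc
  rw [Nat.gcd_comm] at hsc
  have hmem := padicValInt_minimalDiscriminantInt_mem_of_addv_of_padicValRat_j_nonneg W p hp5 hadd hj0
  have ha : padicValInt p W.minimalDiscriminantInt = 2 ∨ padicValInt p W.minimalDiscriminantInt = 3 ∨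
      padicValInt p W.minimalDiscriminantInt = 4 ∨ padicValInt p W.minimalDiscriminantInt = 8 ∨
      padicValInt p W.minimalDiscriminantInt = 9 ∨ padicValInt p W.minimalDiscriminantInt = 10 := by
    rcases hmem with h | h | h | h | h | h | h
    · exact Or.inl h
    · exact Or.inr (Or.inl h)
    · exact Or.inr (Or.inr (Or.inl h))
    · exfalso
      rw [h, show 12 / Nat.gcd 6 12 = 2 by decide] at hsc
      have hp' := (Nat.Prime.eq_two_or_odd hpP).resolve_left hp2
      exact hsc (by omega)
    · exact Or.inr (Or.inr (Or.inr (Or.inl h)))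
    · exact Or.inr (Or.inr (Or.inr (Or.inr (Or.inl h))))
    · exact Or.inr (Or.inr (Or.inr (Or.inr (Or.inr h))))
  exact signLaw_supercuspidal_of_isGloballyMinimal_anyLevel W hmod hF1 hF1' hp5 hN hpM rfl ha
    (dvd_c₄_integralModelInt_of_addv W hadd) (c₄_eq_zero_or_le_of_padicValRat_j_nonneg W hj0) K hK hKodd hpd hodd htwo hsc

/-- **PRINCIPAL-SERIES companion in the sketch's binders, on the POTENTIALLY GOOD non-`I₀*` rows**: `W` global minimal, `p ≥ 5`, `Addv W p`,
`0 ≤ ord_p j` (potentially good — the binder the sketch's `SignLawPrincipalSeries` lacks; on the potentially multiplicative rows the law is FALSE,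
evidence #41), `ord_p Δ_min ≠ 6` (type `I₀*`: g11's `signLaw_IZeroStar_of_isGloballyMinimal`, not restated here), `W.semistabilityDefectAt p ∣ p − 1`,
habitat as above ⟹ `w(E)·w(E^{(d_{K′})}) = −1`. Conditional on {hmod, F1 at `p`}; BSD is not proved by this.
[cite: Serre1972, §5.6 (p. 312)] [cite: Rohrlich1993Compositio, Prop. 2(iv)] [cite: KellockDokchitser2023, Rem. 2.2] -/
theorem rootNumber_mul_rootNumber_twist_discr_eq_neg_one_of_addv_of_semistabilityDefectAt_dvd
    (W : WeierstrassCurve ℚ) [W.IsElliptic] [W.IsGloballyMinimal]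
    (hmod : exists_isNewformOf) (hF1 : W.atkinLehnerEigenvalueAt_eq_localRootNumberAt)
    (hF1' : (W.quadraticTwist (((-1 : ℤ) ^ (p / 2) * p : ℤ) : ℚ)).atkinLehnerEigenvalueAt_eq_localRootNumberAt)
    (hp5 : 5 ≤ p) (hadd : Addv W p) (hj0 : 0 ≤ padicValRat p W.j) (h6 : padicValInt p W.minimalDiscriminantInt ≠ 6)
    (hps : W.semistabilityDefectAt p ∣ p - 1)
    (K : Type) [Field K] [NumberField K] (hK : IsImaginaryQuadratic K) (hKodd : Odd (NumberField.discr K))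
    (hpd : (p : ℤ) ∣ NumberField.discr K)
    (hsplit : ∀ q : ℕ, q.Prime → (q : ℤ) ∣ (W.conductorNorm ℤ : ℤ) → q ≠ p →
      (q ≠ 2 → jacobiSym (NumberField.discr K) q = 1) ∧ (q = 2 → NumberField.discr K % 8 = 1)) :
    W.rootNumber * (W.quadraticTwist (NumberField.discr K : ℚ)).rootNumber = -1 := by
  have hpP : p.Prime := hp.out
  obtain ⟨hN, hpM⟩ := conductorNorm_eq_div_mul_sq_of_addv W hp5 hadd
  set M : ℕ := W.conductorNorm ℤ / p ^ 2 with hM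
  have hqN : ∀ q ∈ M.primeFactors, (q : ℤ) ∣ (W.conductorNorm ℤ : ℤ) ∧ q ≠ p := fun q hq ↦ by
    refine ⟨?_, ?_⟩
    · rw [hN]; push_cast
      exact Dvd.dvd.mul_right (by exact_mod_cast Nat.dvd_of_mem_primeFactors hq) _
    · rintro rfl; exact hpM (Nat.dvd_of_mem_primeFactors hq)
  have hodd : ∀ q ∈ M.primeFactors, q ≠ 2 → J(NumberField.discr K | q) = 1 := fun q hq hq2 ↦
    (hsplit q (Nat.prime_of_mem_primeFactors hq) (hqN q hq).1 (hqN q hq).2).1 hq2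
  have htwo : 2 ∣ M → NumberField.discr K % 8 = 1 := fun h2 ↦ by
    have h2M : 2 ∈ M.primeFactors := Nat.mem_primeFactors.mpr ⟨Nat.prime_two, h2, fun h ↦ by
      rw [h, zero_mul] at hN; exact (W.conductorNorm_pos_holds).ne' hN⟩
    exact (hsplit 2 Nat.prime_two (hqN 2 h2M).1 (hqN 2 h2M).2).2 rfl
  have hdef := SemistabilityDefect.semistabilityDefectAt_eq_semistabilityIndex W p hp5 hj0
  rw [hdef] at hps
  change 12 / Nat.gcd 12 (padicValInt p W.minimalDiscriminantInt) ∣ p - 1 at hps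
  rw [Nat.gcd_comm] at hps
  have hmem := padicValInt_minimalDiscriminantInt_mem_of_addv_of_padicValRat_j_nonneg W p hp5 hadd hj0
  have ha : padicValInt p W.minimalDiscriminantInt = 2 ∨ padicValInt p W.minimalDiscriminantInt = 3 ∨
      padicValInt p W.minimalDiscriminantInt = 4 ∨ padicValInt p W.minimalDiscriminantInt = 8 ∨
      padicValInt p W.minimalDiscriminantInt = 9 ∨ padicValInt p W.minimalDiscriminantInt = 10 := by
    rcases hmem with h | h | h | h | h | h | h
    · exact Or.inl h
    · exact Or.inr (Or.inl h)
    · exact Or.inr (Or.inr (Or.inl h))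
    · exact absurd h h6
    · exact Or.inr (Or.inr (Or.inr (Or.inl h)))
    · exact Or.inr (Or.inr (Or.inr (Or.inr (Or.inl h))))
    · exact Or.inr (Or.inr (Or.inr (Or.inr (Or.inr h))))
  exact signLaw_principalSeries_of_isGloballyMinimal_anyLevel W hmod hF1 hF1' hp5 hN hpM rfl ha
    (dvd_c₄_integralModelInt_of_addv W hadd) (c₄_eq_zero_or_le_of_padicValRat_j_nonneg W hj0) K hK hKodd hpd hodd htwo hps

end Sketch

end Summit.BirchSwinnertonDyer.BirchSwinnertonDyer.Theorems.AdditiveKoly.RamifiedHabitat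

end
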